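import Summits.AnomalousDissipation.AnomalousDissipation.Theorems.MomentParityResolvedDissipationStubLimitSSS
import Summits.AnomalousDissipation.AnomalousDissipation.Theorems.MomentParityResolvedDissipationStubTightExtraction
import Summits.AnomalousDissipation.AnomalousDissipation.Theorems.MomentParityMomentLadderStubClosureAllDegrees
import Summits.AnomalousDissipation.AnomalousDissipation.Theorems.MomentParityResolvedDissipationStubSchedule
import Summits.AnomalousDissipation.AnomalousDissipation.Theorems.MomentLadder.Negative.LoadBearing

/-!
# Crux `MomentParity.MomentLadder` (stmt-AnomalousDissipation-11463), line `Sketch`, lead c2: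
# the resolution clause of the crux IS the mean energy equality of the Galerkin limit

The route thesis (Theses/MomentParity, item `ResolvedDissipation`) asserts informally: "up to
subsequences, the `κ`-clause ⟺ weak limits `N → ∞` of the invariant families satisfy the mean energy
EQUALITY `ν⟨‖∇u‖²⟩ = ⟨(f,u)⟩` instead of FMRT's inequality IV (1.31)". This file makes that a theorem
ON THE WITNESS SIDE, i.e. for the existential crux `X = MomentLadder` itself:

* `exists_schedule_of_limitEnergyEq` — the witness-side twin of K2c (`stub_scheduleOfLimitEnergyEq`,
  which is the `∀`-form for the crux `ResolvedDissipation`), proved DIRECTLY (no kill shape): ONE sequence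
  of admissible level-`N_i` laws (probability, level-`N_i` carried, supported in `‖u‖ ≤ R`, stationary at
  every order for Galerkin NS at `(ν, f)`) whose injections `∫ (u,f) dμ_i` and truncated mean enstrophies
  `∫ ‖∇P_K u‖² dμ_i` converge to those of a law `μ_∞` of finite mean enstrophy satisfying the energy
  EQUALITY `ν ∫ ‖∇u‖² dμ_∞ = ∫ (u,f) dμ_∞` is resolved by ONE schedule: `IsResolved κ (μ_i)` for all `i`.
  Proof: by the level energy rows `∫‖∇u‖² dμ_i = ∫(u,f)dμ_i/ν → ∫(u,f)dμ_∞/ν = ∫‖∇u‖² dμ_∞` (this is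
  where the equality enters); monotone convergence `∫‖∇P_K u‖² dμ_∞ ↑ ∫‖∇u‖² dμ_∞ < ∞` picks `K₀(n)`
  within `1/(3(n+1))`; for `i ≥ i₀(n)` the two convergences give
  `∫‖∇u‖² dμ_i ≤ ∫‖∇P_{K₀}u‖² dμ_i + 1/(n+1)`, and the finitely many earlier laws are resolved EXACTLY at
  any cutoff above their levels; `κ(n) = max (K₀(n), N_0, …, N_{i₀(n)-1})`.
* `MomentLadder_of_limitEnergyEq` — hence the crux follows from: `∃ f` smooth div-free mean-zero,
  `ν_j → 0`, `E`, `ε > 0`, and at every `j` a radius `R_j` and ONE loud admissible sequence at levels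
  `N_i → ∞` (energy `≤ E`, dissipation `≥ ε`) with such an energy-equality limit.
* `limitEnergyEq_of_MomentLadder` — conversely the crux supplies exactly such sequences (moment closure,
  extraction, Rellich–Prokhorov K2a; the limit is even an FMRT stationary statistical solution carried by
  the ball, and the equality is the one proved in `exists_loud_stationaryStatisticalSolution`'s way: `≤` is
  FMRT's `energy_le_holds`, `≥` passes through the truncated enstrophies by the `κ`-clause).
* `momentLadder_iff_limitEnergyEq` — **the dictionary entry**: `MomentLadder` ⟺ loud admissible Galerkin
  sequences along `ν_j → 0` whose limit laws obey the mean energy equality. With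
  `galerkinInvariantLoud_of_MomentLadder` (crux ⟹ stmt-14283) this pins the content of the crux above the
  Galerkin-ensemble zeroth law to ONE classical statement: FMRT IV (1.31) WITH EQUALITY for the limits of
  the witnessing invariant families (known in print only in 2-D, FMRT IV §2 / App. B).

No item is credited; `--supports` helper of stmt-11463 (registered stub `momentLadder_iff_limitEnergyEq`).
Companion of `Theorems/MomentParityMomentLadderEnsembleBridge.lean` (the `N → ∞` bridge to route Ensemble,
`exists_loud_stationaryStatisticalSolution`); the two files are independent of each other.

References: Foias–Manley–Rosa–Temam 2001, Ch. IV §1.2 (1.29)–(1.31), §2, App. B; Billingsley 1999,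
Thms 2.1, 5.1.
-/

noncomputable section

-- `Summit.<Summit>.<Problem>`: single-conjunct summit, the duplicate namespace segment is mandated.
set_option linter.dupNamespace false

namespace Summit.AnomalousDissipation.AnomalousDissipation.Theorems.MomentLadder

open MeasureTheory Filter Topology Set
open scoped ENNReal NNReal
open Literature.Analysis.FunctionSpaces Literature.Analysis.FluidPDE
open Summit.AnomalousDissipation.AnomalousDissipation.Theses.MomentParity
open Summit.AnomalousDissipation.AnomalousDissipation.Theorems.QuarticGate.Negative
open Summit.AnomalousDissipation.AnomalousDissipation.Theorems.MomentLadder.Negative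
open Summit.AnomalousDissipation.AnomalousDissipation.Theorems.MomentParityResolvedDissipation

/-! ## `ℝ≥0∞` bookkeeping -/

/-- From `g i → a` with `a ≠ ⊤`: eventually `g i ≤ a + δ` and `a ≤ g i + δ`, for every `δ > 0`. [folklore] -/
theorem ENNReal.eventually_le_add_and_le_add_of_tendsto {ι : Type*} {l : Filter ι} {g : ι → ℝ≥0∞}
    {a : ℝ≥0∞} (ha : a ≠ ⊤) (hg : Tendsto g l (𝓝 a)) {δ : ℝ≥0∞} (hδ : 0 < δ) :
    ∀ᶠ i in l, g i ≤ a + δ ∧ a ≤ g i + δ := by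
  filter_upwards [(ENNReal.tendsto_nhds ha).1 hg δ hδ] with i hi
  exact ⟨hi.2, tsub_le_iff_right.1 hi.1⟩

/-! ## Witness-side K2c: an energy-equality limit resolves the sequence -/

/-- **One schedule resolves an admissible sequence with an energy-equality limit** (witness-side twin of
K2c `stub_scheduleOfLimitEnergyEq`, direct proof). Let `μ_i` be probability laws carried by level-`N_i`
fields, supported in `‖u‖ ≤ R`, stationary at every order for Galerkin NS at `(ν, f)` (`0 < ν`, `f ∈ L²`),
and let `μ_∞` be a law with finite mean enstrophy and the mean energy EQUALITY
`ν ∫ ‖∇u‖² dμ_∞ = ∫ (u, f) dμ_∞`, such that `∫ (u, f) dμ_i → ∫ (u, f) dμ_∞` and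
`∫ ‖∇P_K u‖² dμ_i → ∫ ‖∇P_K u‖² dμ_∞` for every cutoff `K`. Then ONE schedule `κ` resolves every `μ_i`:
`∫ ‖∇u‖² dμ_i ≤ ∫ ‖∇P_{κ n} u‖² dμ_i + 1/(n+1)` for all `i`, `n`. The levels need not diverge. [folklore] -/
theorem exists_schedule_of_limitEnergyEq {ν : ℝ} (hν : 0 < ν)
    {f : UnitAddTorus (Fin 3) → EuclideanSpace ℝ (Fin 3)} (hf : MemLp f 2 volume) {R : ℝ}
    {Nl : ℕ → ℕ} {μ : ℕ → Measure (Torus.energySpace (Fin 3))}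
    (hp : ∀ i, IsProbabilityMeasure (μ i)) (hl : ∀ i, ∀ᵐ u ∂(μ i), IsLevel (Nl i) u)
    (hb : ∀ i, ∀ᵐ u ∂(μ i), ‖u‖ ≤ R) (hs : ∀ i (d : ℕ), IsPolyStationary ν f (Nl i) d (μ i))
    {μlim : Measure (Torus.energySpace (Fin 3))} (hfin : Torus.ensembleEnstrophy μlim ≠ ⊤)
    (heq : ν * (Torus.ensembleEnstrophy μlim).toReal = ∫ u, Torus.pairing u.1 f ∂μlim)
    (hP : Tendsto (fun i => ∫ u, Torus.pairing u.1 f ∂(μ i)) atTop (𝓝 (∫ u, Torus.pairing u.1 f ∂μlim)))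
    (hT : ∀ K : ℕ, Tendsto (fun i => ∫⁻ u, Torus.eGradNormSq (Torus.fourierTruncate K
        (u.1 : UnitAddTorus (Fin 3) → EuclideanSpace ℝ (Fin 3))) ∂(μ i)) atTop
      (𝓝 (∫⁻ u, Torus.eGradNormSq (Torus.fourierTruncate K
        (u.1 : UnitAddTorus (Fin 3) → EuclideanSpace ℝ (Fin 3))) ∂μlim))) :
    ∃ κ : ℕ → ℕ, ∀ i, IsResolved κ (μ i) := by
  -- notation: truncated mean enstrophies
  set T : ℕ → Measure (Torus.energySpace (Fin 3)) → ℝ≥0∞ := fun K ρ =>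
    ∫⁻ u, Torus.eGradNormSq (Torus.fourierTruncate K
      (u.1 : UnitAddTorus (Fin 3) → EuclideanSpace ℝ (Fin 3))) ∂ρ with hTdef
  -- energy rows: the mean enstrophies converge to the (finite) mean enstrophy of the limit
  have hElim : Torus.ensembleEnstrophy μlim = ENNReal.ofReal ((∫ u, Torus.pairing u.1 f ∂μlim) / ν) := by
    rw [← ENNReal.ofReal_toReal hfin]
    congr 1
    rw [eq_div_iff hν.ne', mul_comm]
    exact heq
  have hE : Tendsto (fun i => Torus.ensembleEnstrophy (μ i)) atTop (𝓝 (Torus.ensembleEnstrophy μlim)) := by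
    have h' : (fun i => Torus.ensembleEnstrophy (μ i)) =
        fun i => ENNReal.ofReal ((∫ u, Torus.pairing u.1 f ∂(μ i)) / ν) :=
      funext fun i => by
        haveI := hp i
        exact Schedule.ensembleEnstrophy_eq_ofReal hν hf (hl i) (hb i) (hs i)
    rw [h', hElim]
    exact ENNReal.tendsto_ofReal (hP.div_const ν)
  -- monotone convergence in the cutoff for the limit law
  have hmono := Schedule.tendsto_lintegral_eGradNormSq_fourierTruncate μlim
  -- truncated enstrophies of the limit are finite
  have hTfin : ∀ K, T K μlim ≠ ⊤ := fun K =>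
    ne_top_of_le_ne_top hfin (lintegral_mono fun u =>
      Torus.eGradNormSq_fourierTruncate_le ((Lp.memLp u.1).integrable one_le_two) K)
  -- exact resolution of a level-`N` law at any cutoff `≥ N`
  have hexact : ∀ i K, Nl i ≤ K → Torus.ensembleEnstrophy (μ i) = T K (μ i) := fun i K hK =>
    lintegral_congr_ae ((hl i).mono fun u hu => (eGradNormSq_fourierTruncate_of_isLevel hu hK).symm)
  -- the key step: for every tolerance one cutoff works for the whole sequence
  have key : ∀ n : ℕ, ∃ K : ℕ, ∀ i, Torus.ensembleEnstrophy (μ i) ≤ T K (μ i) + ((n : ℝ≥0∞) + 1)⁻¹ := by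
    intro n
    -- a third of the tolerance
    set δ : ℝ≥0∞ := ((n : ℝ≥0∞) + 1)⁻¹ / 3 with hδ
    have hδ0 : 0 < δ := ENNReal.div_pos (ENNReal.inv_ne_zero.2 (by simp)) (by simp)
    have h3δ : δ + δ + δ = ((n : ℝ≥0∞) + 1)⁻¹ := by rw [hδ, ENNReal.add_thirds]
    -- `K₀`: the limit law is resolved within `δ` at cutoff `K₀`
    obtain ⟨K₀, hK₀⟩ : ∃ K₀ : ℕ, Torus.ensembleEnstrophy μlim ≤ T K₀ μlim + δ := by
      obtain ⟨K₀, hK₀⟩ := (((ENNReal.tendsto_atTop hfin).1 hmono) δ hδ0)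
      exact ⟨K₀, tsub_le_iff_right.1 (hK₀ K₀ le_rfl).1⟩
    -- `i₀`: beyond it, `E_i ≤ E_∞ + δ` and `T_{K₀} μ_∞ ≤ T_{K₀} μ_i + δ`
    obtain ⟨i₀, hi₀⟩ : ∃ i₀ : ℕ, ∀ i ≥ i₀, Torus.ensembleEnstrophy (μ i) ≤ Torus.ensembleEnstrophy μlim + δ ∧
        T K₀ μlim ≤ T K₀ (μ i) + δ := by
      have h1 := ENNReal.eventually_le_add_and_le_add_of_tendsto hfin hE hδ0
      have h2 := ENNReal.eventually_le_add_and_le_add_of_tendsto (hTfin K₀) (hT K₀) hδ0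
      obtain ⟨i₀, hi₀⟩ := eventually_atTop.1 (h1.and h2)
      exact ⟨i₀, fun i hi => ⟨(hi₀ i hi).1.1, (hi₀ i hi).2.2⟩⟩
    -- the cutoff: `K₀` and the levels of the finitely many early laws
    refine ⟨max K₀ ((Finset.range i₀).sup Nl), fun i => ?_⟩
    by_cases hi : i₀ ≤ i
    · obtain ⟨hEi, hTi⟩ := hi₀ i hi
      have hmon : T K₀ (μ i) ≤ T (max K₀ ((Finset.range i₀).sup Nl)) (μ i) :=
        lintegral_mono fun u => eGradNormSq_fourierTruncate_mono (le_max_left _ _) u.1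
      calc Torus.ensembleEnstrophy (μ i) ≤ Torus.ensembleEnstrophy μlim + δ := hEi
        _ ≤ T K₀ μlim + δ + δ := add_le_add hK₀ le_rfl
        _ ≤ T K₀ (μ i) + δ + δ + δ := by gcongr
        _ = T K₀ (μ i) + ((n : ℝ≥0∞) + 1)⁻¹ := by rw [add_assoc, add_assoc, ← add_assoc δ, h3δ]
        _ ≤ T (max K₀ ((Finset.range i₀).sup Nl)) (μ i) + ((n : ℝ≥0∞) + 1)⁻¹ :=
            add_le_add hmon le_rfl
    · have hi' : i < i₀ := not_le.1 hi
      have hle : Nl i ≤ max K₀ ((Finset.range i₀).sup Nl) :=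
        (Finset.le_sup (f := Nl) (Finset.mem_range.2 hi')).trans (le_max_right _ _)
      rw [hexact i _ hle]
      exact le_self_add
  choose κ hκ using key
  exact ⟨κ, fun i n => hκ n i⟩

/-! ## The crux from loud admissible sequences with energy-equality limits -/

/-- **`MomentLadder` from energy-equality limits.** If for some smooth div-free mean-zero force, `ν_j → 0`,
`E` and `ε > 0`, at every `j` there are a radius `R` and ONE sequence of level-`N_i` probability laws
(`N_i → ∞`) supported in `‖u‖ ≤ R`, stationary at every order for Galerkin NS at `(ν_j, f)`, with mean
energy `≤ E`, dissipation `≥ ε`, whose injections and truncated mean enstrophies converge to those of a law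
of finite mean enstrophy satisfying the mean energy EQUALITY at `ν_j` — then the crux holds (the schedule is
`exists_schedule_of_limitEnergyEq`, the `∃ᶠ N` are the levels `N_i`). [folklore] -/
theorem MomentLadder_of_limitEnergyEq
    (h : ∃ f : UnitAddTorus (Fin 3) → EuclideanSpace ℝ (Fin 3),
      Torus.IsSmooth f ∧ Torus.IsDivFree f ∧ Torus.HasZeroMean f ∧
      ∃ (ν : ℕ → ℝ) (E ε : ℝ), (∀ j, 0 < ν j) ∧ Tendsto ν atTop (𝓝 0) ∧ 0 < ε ∧
        ∀ j : ℕ, ∃ (R : ℝ) (Nl : ℕ → ℕ) (μ : ℕ → Measure (Torus.energySpace (Fin 3))),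
          Tendsto Nl atTop atTop ∧ (∀ i, IsProbabilityMeasure (μ i)) ∧
          (∀ i, ∀ᵐ u ∂(μ i), IsLevel (Nl i) u) ∧ (∀ i, IsSupported R (μ i)) ∧
          (∀ i (d : ℕ), IsPolyStationary (ν j) f (Nl i) d (μ i)) ∧
          (∀ i, Torus.ensembleEnergy (μ i) ≤ E) ∧ (∀ i, ε ≤ Torus.ensembleDissipation (ν j) (μ i)) ∧
          ∃ μlim : Measure (Torus.energySpace (Fin 3)), Torus.ensembleEnstrophy μlim ≠ ⊤ ∧
            ν j * (Torus.ensembleEnstrophy μlim).toReal = ∫ u, Torus.pairing u.1 f ∂μlim ∧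
            Tendsto (fun i => ∫ u, Torus.pairing u.1 f ∂(μ i)) atTop
              (𝓝 (∫ u, Torus.pairing u.1 f ∂μlim)) ∧
            ∀ K : ℕ, Tendsto (fun i => ∫⁻ u, Torus.eGradNormSq (Torus.fourierTruncate K
                (u.1 : UnitAddTorus (Fin 3) → EuclideanSpace ℝ (Fin 3))) ∂(μ i)) atTop
              (𝓝 (∫⁻ u, Torus.eGradNormSq (Torus.fourierTruncate K
                (u.1 : UnitAddTorus (Fin 3) → EuclideanSpace ℝ (Fin 3))) ∂μlim))) :
    MomentLadder := by
  obtain ⟨f, hfs, hfd, hfz, ν, E, ε, hν, hν0, hε, hj⟩ := h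
  refine momentLadder_iff.2 ⟨f, hfs, hfd, hfz, ν, E, ε, hν, hν0, hε, fun j => ?_⟩
  obtain ⟨R, Nl, μ, hNl, hp, hl, hb, hs, hE, hD, μlim, hfin, heq, hP, hT⟩ := hj j
  obtain ⟨κ, hκ⟩ := exists_schedule_of_limitEnergyEq (hν j) (hfs.memLp 2) hp hl hb hs hfin heq hP hT
  refine ⟨R, κ, frequently_atTop.2 fun a => ?_⟩
  obtain ⟨i, hi⟩ := (tendsto_atTop.1 hNl a).exists
  exact ⟨Nl i, hi, fun d => ⟨μ i, hp i, hl i, hb i, hκ i, hs i d, hE i, hD i⟩⟩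

/-! ## Conversely: the crux supplies such sequences (and the limits are stationary statistical solutions) -/

/-- **Energy-equality limits from `MomentLadder`.** The crux supplies, at every `j`, a radius and ONE loud
admissible sequence at levels `N_i → ∞` converging (injections and truncated mean enstrophies) to a law of
finite mean enstrophy with the mean energy EQUALITY at `ν_j` — in fact to an FMRT stationary statistical
solution carried by the ball (moment closure at every degree, extraction of levels, Rellich–Prokhorov K2a,
limit-is-SSS K2b; `≤` of the equality is FMRT's `energy_le_holds`, `≥` passes through the truncated
enstrophies by the `κ`-clause). [folklore] -/
theorem limitEnergyEq_of_MomentLadder (h : MomentLadder) :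
    ∃ f : UnitAddTorus (Fin 3) → EuclideanSpace ℝ (Fin 3),
      Torus.IsSmooth f ∧ Torus.IsDivFree f ∧ Torus.HasZeroMean f ∧
      ∃ (ν : ℕ → ℝ) (E ε : ℝ), (∀ j, 0 < ν j) ∧ Tendsto ν atTop (𝓝 0) ∧ 0 < ε ∧
        ∀ j : ℕ, ∃ (R : ℝ) (Nl : ℕ → ℕ) (μ : ℕ → Measure (Torus.energySpace (Fin 3))),
          Tendsto Nl atTop atTop ∧ (∀ i, IsProbabilityMeasure (μ i)) ∧
          (∀ i, ∀ᵐ u ∂(μ i), IsLevel (Nl i) u) ∧ (∀ i, IsSupported R (μ i)) ∧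
          (∀ i (d : ℕ), IsPolyStationary (ν j) f (Nl i) d (μ i)) ∧
          (∀ i, Torus.ensembleEnergy (μ i) ≤ E) ∧ (∀ i, ε ≤ Torus.ensembleDissipation (ν j) (μ i)) ∧
          ∃ μlim : Measure (Torus.energySpace (Fin 3)), Torus.ensembleEnstrophy μlim ≠ ⊤ ∧
            ν j * (Torus.ensembleEnstrophy μlim).toReal = ∫ u, Torus.pairing u.1 f ∂μlim ∧
            Tendsto (fun i => ∫ u, Torus.pairing u.1 f ∂(μ i)) atTop
              (𝓝 (∫ u, Torus.pairing u.1 f ∂μlim)) ∧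
            ∀ K : ℕ, Tendsto (fun i => ∫⁻ u, Torus.eGradNormSq (Torus.fourierTruncate K
                (u.1 : UnitAddTorus (Fin 3) → EuclideanSpace ℝ (Fin 3))) ∂(μ i)) atTop
              (𝓝 (∫⁻ u, Torus.eGradNormSq (Torus.fourierTruncate K
                (u.1 : UnitAddTorus (Fin 3) → EuclideanSpace ℝ (Fin 3))) ∂μlim)) := by
  obtain ⟨f, hfs, hfd, hfz, ν, E, ε, hν, hν0, hε, hj⟩ := momentLadder_iff.1 h
  refine ⟨f, hfs, hfd, hfz, ν, E, ε, hν, hν0, hε, fun j => ?_⟩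
  obtain ⟨R, κ, hfreq⟩ := hj j
  have hf2 : MemLp f 2 volume := hfs.memLp 2
  -- levels `N_i → ∞` carrying witnesses of every order, closed in `d`
  obtain ⟨Ns, hNs, hP⟩ := extraction_of_frequently_atTop hfreq
  choose μ hp hl hsupp hres hstat hE hD using
    fun i => stub_closureAllDegrees f hfs (ν j) (Ns i) E ε R κ (hP i)
  -- the `N`-uniform enstrophy budget `4π²κ(0)²R² + 1` (resolution at `n = 0` and Bernstein)
  have hM : ∀ i, Torus.ensembleEnstrophy (μ i) ≤
      (((4 * Real.pi ^ 2 * (κ 0 : ℝ) ^ 2 * R ^ 2 + 1).toNNReal : ℝ≥0) : ℝ≥0∞) := fun i => by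
    haveI := hp i
    have h1 := (hres i).ensembleEnstrophy_le 0
    have h0 : (((0 : ℕ) : ℝ≥0∞) + 1)⁻¹ = 1 := by simp
    rw [h0] at h1
    have h2 : ∫⁻ u, ‖u‖ₑ ^ 2 ∂(μ i) ≤ ENNReal.ofReal (R ^ 2) := by
      calc ∫⁻ u, ‖u‖ₑ ^ 2 ∂(μ i) ≤ ∫⁻ _, ENNReal.ofReal (R ^ 2) ∂(μ i) :=
            lintegral_mono_ae (Filter.Eventually.mono (hsupp i) fun u hu => by
              rw [← ofReal_norm, ← ENNReal.ofReal_pow (norm_nonneg _)]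
              exact ENNReal.ofReal_le_ofReal (pow_le_pow_left₀ (norm_nonneg _) hu 2))
        _ = ENNReal.ofReal (R ^ 2) := by rw [lintegral_const, measure_univ, mul_one]
    calc Torus.ensembleEnstrophy (μ i)
        ≤ ENNReal.ofReal (4 * Real.pi ^ 2 * (κ 0 : ℝ) ^ 2) * (∫⁻ u, ‖u‖ₑ ^ 2 ∂(μ i)) + 1 := h1
      _ ≤ ENNReal.ofReal (4 * Real.pi ^ 2 * (κ 0 : ℝ) ^ 2) * ENNReal.ofReal (R ^ 2) + 1 := by gcongr
      _ = ENNReal.ofReal (4 * Real.pi ^ 2 * (κ 0 : ℝ) ^ 2 * R ^ 2 + 1) := by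
          rw [← ENNReal.ofReal_mul (by positivity), ENNReal.ofReal_add (by positivity) zero_le_one,
            ENNReal.ofReal_one]
  -- Rellich–Prokhorov extraction (K2a) and limit-is-SSS (K2b)
  obtain ⟨φ, hφ, μlim, hplim, hball, hBC, hLSC, hTE, hPI⟩ :=
    TightExtraction.stub_tightExtraction R _ μ hp (fun i => hsupp i) hM
  haveI := hplim
  have hNφ : Tendsto (Ns ∘ φ) atTop atTop := hNs.tendsto_atTop.comp hφ.tendsto_atTop
  have hSSS : Torus.IsStationaryStatisticalSolution (ν j) f μlim :=
    LimitSSS.stub_limitIsStationarySolution (ν j) f R (hν j) hf2 (Ns ∘ φ) (fun i => μ (φ i))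
      (fun i => hp (φ i)) (fun i => hl (φ i)) (fun i => hsupp (φ i)) (fun i d => hstat (φ i) d)
      hNφ μlim hplim hball hBC hLSC
  have hne : Torus.ensembleEnstrophy μlim ≠ ⊤ := hSSS.enstrophy_finite.ne
  -- the mean energy EQUALITY of the limit
  have hEq : ν j * (Torus.ensembleEnstrophy μlim).toReal = ∫ u, Torus.pairing u.1 f ∂μlim := by
    refine le_antisymm (Torus.IsStationaryStatisticalSolution.energy_le_holds hSSS hf2) ?_
    have hrow : ∀ i, Torus.ensembleEnstrophy (μ (φ i)) =
        ENNReal.ofReal ((∫ u, Torus.pairing u.1 f ∂(μ (φ i))) / ν j) := fun i => by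
      haveI := hp (φ i)
      exact Schedule.ensembleEnstrophy_eq_ofReal (hν j) hf2 (hl (φ i)) (hsupp (φ i)) (hstat (φ i))
    have hPl : Tendsto (fun i => ENNReal.ofReal ((∫ u, Torus.pairing u.1 f ∂(μ (φ i))) / ν j)) atTop
        (𝓝 (ENNReal.ofReal ((∫ u, Torus.pairing u.1 f ∂μlim) / ν j))) :=
      ENNReal.tendsto_ofReal ((hPI f hf2).div_const (ν j))
    have h1 : ∀ n : ℕ, ENNReal.ofReal ((∫ u, Torus.pairing u.1 f ∂μlim) / ν j) ≤
        Torus.ensembleEnstrophy μlim + ((n : ℝ≥0∞) + 1)⁻¹ := by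
      intro n
      have h2 : ENNReal.ofReal ((∫ u, Torus.pairing u.1 f ∂μlim) / ν j) ≤
          (∫⁻ u, Torus.eGradNormSq (Torus.fourierTruncate (κ n)
            (u.1 : UnitAddTorus (Fin 3) → EuclideanSpace ℝ (Fin 3))) ∂μlim) + ((n : ℝ≥0∞) + 1)⁻¹ :=
        le_of_tendsto_of_tendsto' hPl ((hTE (κ n)).add_const _) fun i =>
          (hrow i).symm.le.trans (hres (φ i) n)
      refine h2.trans (add_le_add (lintegral_mono fun u => ?_) le_rfl)
      exact Torus.eGradNormSq_fourierTruncate_le ((Lp.memLp u.1).integrable one_le_two) (κ n)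
    have h0 : Tendsto (fun n : ℕ => Torus.ensembleEnstrophy μlim + ((n : ℝ≥0∞) + 1)⁻¹) atTop
        (𝓝 (Torus.ensembleEnstrophy μlim)) := by
      have hc := ENNReal.tendsto_inv_nat_nhds_zero.comp (tendsto_add_atTop_nat 1)
      have h' : Tendsto (fun n : ℕ => ((n : ℝ≥0∞) + 1)⁻¹) atTop (𝓝 0) :=
        hc.congr fun n => by simp [Function.comp]
      simpa using h'.const_add (Torus.ensembleEnstrophy μlim)
    have h3 := (ENNReal.ofReal_le_iff_le_toReal hne).1 (ge_of_tendsto' h0 h1)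
    rwa [div_le_iff₀ (hν j), mul_comm] at h3
  exact ⟨R, Ns ∘ φ, fun i => μ (φ i), hNφ, fun i => hp (φ i), fun i => hl (φ i), fun i => hsupp (φ i),
    fun i d => hstat (φ i) d, fun i => hE (φ i), fun i => hD (φ i), μlim, hne, hEq, hPI f hf2, hTE⟩

/-- **The dictionary entry: the resolution clause of the crux is the mean energy equality of the Galerkin
limit.** `MomentParity.MomentLadder` ⟺ for some smooth div-free mean-zero force, `ν_j → 0`, `E`, `ε > 0`:
at every `j` a radius `R_j` and ONE sequence of level-`N_i` probability laws (`N_i → ∞`) supported in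
`‖u‖ ≤ R_j`, stationary at every order for Galerkin NS at `(ν_j, f)`, with mean energy `≤ E` and
dissipation `≥ ε`, whose injections `∫ (u,f) dμ_i` and truncated mean enstrophies `∫ ‖∇P_K u‖² dμ_i`
converge to those of a law of finite mean enstrophy obeying FMRT IV (1.31) WITH EQUALITY,
`ν_j ∫ ‖∇u‖² dμ_∞ = ∫ (u, f) dμ_∞`. Unconditional; credits no item. [folklore] -/
theorem momentLadder_iff_limitEnergyEq :
    MomentLadder ↔ ∃ f : UnitAddTorus (Fin 3) → EuclideanSpace ℝ (Fin 3),
      Torus.IsSmooth f ∧ Torus.IsDivFree f ∧ Torus.HasZeroMean f ∧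
      ∃ (ν : ℕ → ℝ) (E ε : ℝ), (∀ j, 0 < ν j) ∧ Tendsto ν atTop (𝓝 0) ∧ 0 < ε ∧
        ∀ j : ℕ, ∃ (R : ℝ) (Nl : ℕ → ℕ) (μ : ℕ → Measure (Torus.energySpace (Fin 3))),
          Tendsto Nl atTop atTop ∧ (∀ i, IsProbabilityMeasure (μ i)) ∧
          (∀ i, ∀ᵐ u ∂(μ i), IsLevel (Nl i) u) ∧ (∀ i, IsSupported R (μ i)) ∧
          (∀ i (d : ℕ), IsPolyStationary (ν j) f (Nl i) d (μ i)) ∧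
          (∀ i, Torus.ensembleEnergy (μ i) ≤ E) ∧ (∀ i, ε ≤ Torus.ensembleDissipation (ν j) (μ i)) ∧
          ∃ μlim : Measure (Torus.energySpace (Fin 3)), Torus.ensembleEnstrophy μlim ≠ ⊤ ∧
            ν j * (Torus.ensembleEnstrophy μlim).toReal = ∫ u, Torus.pairing u.1 f ∂μlim ∧
            Tendsto (fun i => ∫ u, Torus.pairing u.1 f ∂(μ i)) atTop
              (𝓝 (∫ u, Torus.pairing u.1 f ∂μlim)) ∧
            ∀ K : ℕ, Tendsto (fun i => ∫⁻ u, Torus.eGradNormSq (Torus.fourierTruncate K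
                (u.1 : UnitAddTorus (Fin 3) → EuclideanSpace ℝ (Fin 3))) ∂(μ i)) atTop
              (𝓝 (∫⁻ u, Torus.eGradNormSq (Torus.fourierTruncate K
                (u.1 : UnitAddTorus (Fin 3) → EuclideanSpace ℝ (Fin 3))) ∂μlim)) :=
  ⟨limitEnergyEq_of_MomentLadder, MomentLadder_of_limitEnergyEq⟩

end Summit.AnomalousDissipation.AnomalousDissipation.Theorems.MomentLadder

end
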